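import Summits.BirchSwinnertonDyer.BirchSwinnertonDyer.Theorems.ByReductionTypeAtTwoTowerLayerKatoHalf
import Literature.NumberTheory.EllipticCurves.Greenberg1999.ControlLocalKernelsLayerGoodProofs
import HarnessLib

/-!
# The TOWER doors with the binder `h33g` DISCHARGED (route ByReductionTypeAtTwo, crux
# `OrdKatoHalfAtTwo`, item stmt-BirchSwinnertonDyer-19271; seat bsd-2adic-tower-1 GEN 3, part 13)

HONEST FRAMING (cell `bsd-2adic`, run/shared/lean/pub/bsd-2adic/, HUMAN RULINGS D-0036/D-0074): THEOREMS
ONLY; nothing asserted; no definition; no new named fact; closes nothing by itself.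

Parts 9–12 (`…TowerLayerCert`, `…TowerLayerUpper`, `…TowerLayerKatoHalf`) display, among their PRINT
binders, `h33g : lemma33_localTowerKerPrimary_eq_bot_of_good` — Greenberg, LNM 1716, Lemma 3.3, second
part ("If `E` has good reduction at `v`, then `ker(r_{v_n}) = 0` for all `n`"), the hypothesis (h0)
that the local tower kernels vanish off the finite set of bad places at EVERY layer. That named fact is
now a THEOREM of the tree (`Literature.NumberTheory.EllipticCurves.Greenberg1999.lemma33_localTowerKerPrimary_eq_bot_of_good_holds`,
file `Greenberg1999/ControlLocalKernelsLayerGoodProofs`, this seat: inertia-group inflation–restriction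
at the layer `n`, divisibility of `E[p^∞]`, finiteness of Frobenius-fixed torsion through the
reduction map). This file re-issues the doors of record WITHOUT `h33g`:

* `towerGapAtTwo_of_layerSelmer_cert'` / `towerGapAtTwo_of_layerSelmer_cert_upper'` — the GAP
  certificate `O1.TowerGapAtTwo W` from two layer counts / ONE layer count;
* `katoHalfAt_two_of_layerSelmer_cert_gap'` / `katoHalfAt_two_of_layerSelmer_cert_upper_gap'` — the item
  `OrdKatoHalfAtTwo` AT `W` (`O1.MainConjectureLowerDivisibilityAtTwoOrd W`), any analytic rank;
* `bsdp_two_of_layerSelmer_cert_of_missingLowerBoundAt'` /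
  `mazurMainConjecture_two_of_layerSelmer_cert_of_missingLowerBoundAt'` — `BSDp W 2` and
  `MazurMainConjecture W 2` at analytic rank `0` (`Ш`-currency).

Displayed PRINT binders after this part: `h17` (Kato 17.4 (1)(2)@2), `hM`/`hA` (Greenberg L.3.3 p. 88
readings at bad `ℓ ≠ 2`), `hS34` (L.3.4 structure at `2`) [+ `hEC`, `hmod`, `hGZK` for `BSDp`]; the
CERTIFICATE binders are unchanged (`hper₀`, odd torsion, `P/hP/hΔ`, `C/e/k` with `he/hC`, the layer
Selmer count(s), the closed arithmetic, `MissingLowerBoundAt W 2` for `BSDp`).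

References: R. Greenberg, LNM 1716 (1999), §3 Lemmas 3.3–3.5 (PDF pp. 86–90), Prop. 2.5, Thm. 4.1;
K. Kato, Astérisque 295 (2004), Thm. 17.4.
-/

set_option autoImplicit false

noncomputable section

open scoped Classical MatrixGroups ModularForm

open NumberField IsDedekindDomain CongruenceSubgroup WeierstrassCurve Literature.NumberTheory.EllipticCurves
  Literature.NumberTheory.EllipticCurves.ModularForms Literature.NumberTheory.EllipticCurves.Rank1Residual
  Literature.NumberTheory.EllipticCurves.Rank1Residual.Typed
  Literature.NumberTheory.EllipticCurves.Greenberg1999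
  Summit.BirchSwinnertonDyer.Rank1Residual.X1.MuLambda
  Summit.BirchSwinnertonDyer.Rank1Residual.X1.MuPart
  Summit.BirchSwinnertonDyer.Rank1Residual.X1.ParitySqueeze
  Summit.BirchSwinnertonDyer.BirchSwinnertonDyer.Theorems.Rank1ResidualX1Defs
  Summit.BirchSwinnertonDyer.Rank1Residual.X5 Summit.BirchSwinnertonDyer.Rank1Residual.X5.O1
  Summit.BirchSwinnertonDyer.Rank1Residual.X5.TowerGap
  Summit.BirchSwinnertonDyer.Rank1Residual

namespace Summit.BirchSwinnertonDyer.BirchSwinnertonDyer.Theorems.KatoHalfPinch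

section Curve

variable (W : WeierstrassCurve ℚ) [W.IsElliptic] [W.IsGloballyMinimal]

/-- **The GAP certificate (two layer counts), `h33g` discharged**: as `towerGapAtTwo_of_layerSelmer_cert`
with Greenberg's Lemma 3.3 (good `ℓ ≠ 2`, all layers) supplied by the tree's theorem
`lemma33_localTowerKerPrimary_eq_bot_of_good_holds`.
[cite: GreenbergLNM1716, §3 Lemmas 3.3–3.5 (PDF pp. 86–90), Prop. 2.5] [cite: SilvermanAEC2009, VII.1 Prop. 1.3, VII.5.1] -/
theorem towerGapAtTwo_of_layerSelmer_cert'
    (hM : lemma33_localTowerKerPrimary_cyclic_of_multiplicative.{0})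
    (hA : lemma33_natCard_localTowerKerPrimary_le_four_of_additive.{0})
    (hS34 : lemma34_localTowerKerPrimary_cyclicExtension_rat)
    (hgo : GoodOrd W 2) (htors : ¬ 2 ∣ W.torsionOrder) {j j' a d : ℕ} (hjj' : j ≤ j')
    (P : Finset ℕ) (hP : ∀ ℓ ∈ P, ℓ.Prime ∧ ℓ ≠ 2)
    (hΔ : ∀ ℓ : ℕ, ℓ.Prime → ℓ ≠ 2 → (ℓ : ℤ) ∣ W.minimalDiscriminantInt → ℓ ∈ P)
    (C e k : ℕ → ℕ) (he : ∀ ℓ ∈ P, ¬ 2 ^ (e ℓ + 4) ∣ ℓ ^ 2 - 1)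
    (hC : ∀ (ℓ : ℕ) [Fact ℓ.Prime], ℓ ∈ P →
      4 ≤ C ℓ ∨ (W.HasMultiplicativeReductionAtPrime ℓ ∧ 2 ≤ C ℓ) ∨
        (W.HasMultiplicativeReductionAtPrime ℓ ∧ (ℓ : ℤ) ^ k ℓ ∣ W.minimalDiscriminantInt ∧
          ¬ (ℓ : ℤ) ^ (k ℓ + 1) ∣ W.minimalDiscriminantInt ∧ ¬ 2 ∣ k ℓ ∧ 1 ≤ C ℓ) ∨
        (¬ (ℓ : ℤ) ∣ W.minimalDiscriminantInt ∧ 1 ≤ C ℓ))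
    (hlow : ∀ κ : ZpExtension ℚ 2, κ.IsCyclotomic →
      2 ^ a ≤ Nat.card {z : W.selmerLayer κ j // 2 • z = 0})
    (hup : ∀ κ : ZpExtension ℚ 2, κ.IsCyclotomic →
      Nat.card {z : W.selmerLayer κ j' // 2 • z = 0} ≤ 2 ^ d)
    (harith : 2 ^ d * 4 * ∏ ℓ ∈ P, C ℓ ^ 2 ^ min j' (e ℓ) < 2 ^ (2 ^ j' - 2 ^ j + a)) :
    TowerGapAtTwo W :=
  towerGapAtTwo_of_layerSelmer_cert W lemma33_localTowerKerPrimary_eq_bot_of_good_holds hM hA hS34 hgo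
    htors hjj' P hP hΔ C e k he hC hlow hup harith

/-- **The GAP certificate from ONE layer count, `h33g` discharged** (as
`towerGapAtTwo_of_layerSelmer_cert_upper`). [cite: GreenbergLNM1716, §3 Lemmas 3.1, 3.3–3.5, Prop. 2.5] -/
theorem towerGapAtTwo_of_layerSelmer_cert_upper'
    (hM : lemma33_localTowerKerPrimary_cyclic_of_multiplicative.{0})
    (hA : lemma33_natCard_localTowerKerPrimary_le_four_of_additive.{0})
    (hS34 : lemma34_localTowerKerPrimary_cyclicExtension_rat)
    (hgo : GoodOrd W 2) (htors : ¬ 2 ∣ W.torsionOrder) {j' d : ℕ}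
    (P : Finset ℕ) (hP : ∀ ℓ ∈ P, ℓ.Prime ∧ ℓ ≠ 2)
    (hΔ : ∀ ℓ : ℕ, ℓ.Prime → ℓ ≠ 2 → (ℓ : ℤ) ∣ W.minimalDiscriminantInt → ℓ ∈ P)
    (C e k : ℕ → ℕ) (he : ∀ ℓ ∈ P, ¬ 2 ^ (e ℓ + 4) ∣ ℓ ^ 2 - 1)
    (hC : ∀ (ℓ : ℕ) [Fact ℓ.Prime], ℓ ∈ P →
      4 ≤ C ℓ ∨ (W.HasMultiplicativeReductionAtPrime ℓ ∧ 2 ≤ C ℓ) ∨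
        (W.HasMultiplicativeReductionAtPrime ℓ ∧ (ℓ : ℤ) ^ k ℓ ∣ W.minimalDiscriminantInt ∧
          ¬ (ℓ : ℤ) ^ (k ℓ + 1) ∣ W.minimalDiscriminantInt ∧ ¬ 2 ∣ k ℓ ∧ 1 ≤ C ℓ) ∨
        (¬ (ℓ : ℤ) ∣ W.minimalDiscriminantInt ∧ 1 ≤ C ℓ))
    (hup : ∀ κ : ZpExtension ℚ 2, κ.IsCyclotomic →
      Nat.card {z : W.selmerLayer κ j' // 2 • z = 0} ≤ 2 ^ d)
    (harith : 2 ^ d * 4 * ∏ ℓ ∈ P, C ℓ ^ 2 ^ min j' (e ℓ) < 2 ^ (2 ^ j' - 1)) :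
    TowerGapAtTwo W :=
  towerGapAtTwo_of_layerSelmer_cert_upper W lemma33_localTowerKerPrimary_eq_bot_of_good_holds hM hA hS34
    hgo htors P hP hΔ C e k he hC hup harith

/-- **The item `OrdKatoHalfAtTwo` AT `W` from the GAP certificate alone (two layer counts), `h33g`
discharged.** PRINT: `h17`, `hM`, `hA`, `hS34`; CERTIFICATES as in `katoHalfAt_two_of_layerSelmer_cert_gap`.
Any analytic rank. [cite: Kato2004Asterisque, Thm. 17.4 (1)(2) (p. 273)]
[cite: GreenbergLNM1716, §3 Lemmas 3.3–3.5 (PDF pp. 86–90), Prop. 2.5] -/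
theorem katoHalfAt_two_of_layerSelmer_cert_gap'
    (h17 : ∀ [NeZero (W.conductorNorm ℤ)] (f : CuspForm (Gamma0 (W.conductorNorm ℤ)) 2),
      kato_divisibility_allPrimes W 2 (f := f))
    (hM : lemma33_localTowerKerPrimary_cyclic_of_multiplicative.{0})
    (hA : lemma33_natCard_localTowerKerPrimary_le_four_of_additive.{0})
    (hS34 : lemma34_localTowerKerPrimary_cyclicExtension_rat)
    (hper₀ : ∀ [NeZero (W.conductorNorm ℤ)] (f : CuspForm (Gamma0 (W.conductorNorm ℤ)) 2),
      IsNewformOf W f → ∀ ϖ : ℚ, (ϖ : ℝ) * W.realPeriodRat = plusPeriod f → 0 ≤ padicValRat 2 ϖ)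
    (hgo : GoodOrd W 2) (htors : ¬ 2 ∣ W.torsionOrder) {j j' a d : ℕ} (hjj' : j ≤ j')
    (P : Finset ℕ) (hP : ∀ ℓ ∈ P, ℓ.Prime ∧ ℓ ≠ 2)
    (hΔ : ∀ ℓ : ℕ, ℓ.Prime → ℓ ≠ 2 → (ℓ : ℤ) ∣ W.minimalDiscriminantInt → ℓ ∈ P)
    (C e k : ℕ → ℕ) (he : ∀ ℓ ∈ P, ¬ 2 ^ (e ℓ + 4) ∣ ℓ ^ 2 - 1)
    (hC : ∀ (ℓ : ℕ) [Fact ℓ.Prime], ℓ ∈ P →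
      4 ≤ C ℓ ∨ (W.HasMultiplicativeReductionAtPrime ℓ ∧ 2 ≤ C ℓ) ∨
        (W.HasMultiplicativeReductionAtPrime ℓ ∧ (ℓ : ℤ) ^ k ℓ ∣ W.minimalDiscriminantInt ∧
          ¬ (ℓ : ℤ) ^ (k ℓ + 1) ∣ W.minimalDiscriminantInt ∧ ¬ 2 ∣ k ℓ ∧ 1 ≤ C ℓ) ∨
        (¬ (ℓ : ℤ) ∣ W.minimalDiscriminantInt ∧ 1 ≤ C ℓ))
    (hlow : ∀ κ : ZpExtension ℚ 2, κ.IsCyclotomic →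
      2 ^ a ≤ Nat.card {z : W.selmerLayer κ j // 2 • z = 0})
    (hup : ∀ κ : ZpExtension ℚ 2, κ.IsCyclotomic →
      Nat.card {z : W.selmerLayer κ j' // 2 • z = 0} ≤ 2 ^ d)
    (harith : 2 ^ d * 4 * ∏ ℓ ∈ P, C ℓ ^ 2 ^ min j' (e ℓ) < 2 ^ (2 ^ j' - 2 ^ j + a)) :
    MainConjectureLowerDivisibilityAtTwoOrd W :=
  katoHalfAt_two_of_towerGap_of_neron W h17 hper₀ hgo
    (towerGapAtTwo_of_layerSelmer_cert' W hM hA hS34 hgo htors hjj' P hP hΔ C e k he hC hlow hup harith)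

/-- **The item `OrdKatoHalfAtTwo` AT `W` from ONE layer count, `h33g` discharged** (as
`katoHalfAt_two_of_layerSelmer_cert_upper_gap`). [cite: Kato2004Asterisque, Thm. 17.4 (1)(2) (p. 273)]
[cite: GreenbergLNM1716, §3 Lemmas 3.1, 3.3–3.5, Prop. 2.5] -/
theorem katoHalfAt_two_of_layerSelmer_cert_upper_gap'
    (h17 : ∀ [NeZero (W.conductorNorm ℤ)] (f : CuspForm (Gamma0 (W.conductorNorm ℤ)) 2),
      kato_divisibility_allPrimes W 2 (f := f))
    (hM : lemma33_localTowerKerPrimary_cyclic_of_multiplicative.{0})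
    (hA : lemma33_natCard_localTowerKerPrimary_le_four_of_additive.{0})
    (hS34 : lemma34_localTowerKerPrimary_cyclicExtension_rat)
    (hper₀ : ∀ [NeZero (W.conductorNorm ℤ)] (f : CuspForm (Gamma0 (W.conductorNorm ℤ)) 2),
      IsNewformOf W f → ∀ ϖ : ℚ, (ϖ : ℝ) * W.realPeriodRat = plusPeriod f → 0 ≤ padicValRat 2 ϖ)
    (hgo : GoodOrd W 2) (htors : ¬ 2 ∣ W.torsionOrder) {j' d : ℕ}
    (P : Finset ℕ) (hP : ∀ ℓ ∈ P, ℓ.Prime ∧ ℓ ≠ 2)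
    (hΔ : ∀ ℓ : ℕ, ℓ.Prime → ℓ ≠ 2 → (ℓ : ℤ) ∣ W.minimalDiscriminantInt → ℓ ∈ P)
    (C e k : ℕ → ℕ) (he : ∀ ℓ ∈ P, ¬ 2 ^ (e ℓ + 4) ∣ ℓ ^ 2 - 1)
    (hC : ∀ (ℓ : ℕ) [Fact ℓ.Prime], ℓ ∈ P →
      4 ≤ C ℓ ∨ (W.HasMultiplicativeReductionAtPrime ℓ ∧ 2 ≤ C ℓ) ∨
        (W.HasMultiplicativeReductionAtPrime ℓ ∧ (ℓ : ℤ) ^ k ℓ ∣ W.minimalDiscriminantInt ∧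
          ¬ (ℓ : ℤ) ^ (k ℓ + 1) ∣ W.minimalDiscriminantInt ∧ ¬ 2 ∣ k ℓ ∧ 1 ≤ C ℓ) ∨
        (¬ (ℓ : ℤ) ∣ W.minimalDiscriminantInt ∧ 1 ≤ C ℓ))
    (hup : ∀ κ : ZpExtension ℚ 2, κ.IsCyclotomic →
      Nat.card {z : W.selmerLayer κ j' // 2 • z = 0} ≤ 2 ^ d)
    (harith : 2 ^ d * 4 * ∏ ℓ ∈ P, C ℓ ^ 2 ^ min j' (e ℓ) < 2 ^ (2 ^ j' - 1)) :
    MainConjectureLowerDivisibilityAtTwoOrd W :=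
  katoHalfAt_two_of_towerGap_of_neron W h17 hper₀ hgo
    (towerGapAtTwo_of_layerSelmer_cert_upper' W hM hA hS34 hgo htors P hP hΔ C e k he hC hup harith)

/-- **Door (`Ш`-currency, decidable certificates) for `BSD(E,2)` at analytic rank `0`, `h33g`
discharged.** PRINT: `hmod`, `hGZK`, `h17`, `hEC`, `hM`, `hA`, `hS34`; CERTIFICATES as in
`bsdp_two_of_layerSelmer_cert_of_missingLowerBoundAt`.
[cite: GreenbergLNM1716, Thm. 4.1 (p. 102), §3 Lemmas 3.3–3.5, Prop. 2.5] [cite: Kato2004Asterisque, Thm. 17.4 (1)(2) (p. 273)]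
[cite: Miller2011LMS, Def. 1.1] -/
theorem bsdp_two_of_layerSelmer_cert_of_missingLowerBoundAt'
    (hmod : nonempty_modularParametrizationData) (hGZK : rank_eq_analyticRank_of_analyticRank_le_one)
    (h17 : ∀ [NeZero (W.conductorNorm ℤ)] (f : CuspForm (Gamma0 (W.conductorNorm ℤ)) 2),
      kato_divisibility_allPrimes W 2 (f := f))
    (hEC : TwoAdicEulerCharRankZero W 0)
    (hM : lemma33_localTowerKerPrimary_cyclic_of_multiplicative.{0})
    (hA : lemma33_natCard_localTowerKerPrimary_le_four_of_additive.{0})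
    (hS34 : lemma34_localTowerKerPrimary_cyclicExtension_rat)
    (hper₀ : ∀ [NeZero (W.conductorNorm ℤ)] (f : CuspForm (Gamma0 (W.conductorNorm ℤ)) 2),
      IsNewformOf W f → ∀ ϖ : ℚ, (ϖ : ℝ) * W.realPeriodRat = plusPeriod f → 0 ≤ padicValRat 2 ϖ)
    (hgo : GoodOrd W 2) (hr : W.analyticRank = 0) (htors : ¬ 2 ∣ W.torsionOrder) {j j' a d : ℕ}
    (hjj' : j ≤ j') (P : Finset ℕ) (hP : ∀ ℓ ∈ P, ℓ.Prime ∧ ℓ ≠ 2)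
    (hΔ : ∀ ℓ : ℕ, ℓ.Prime → ℓ ≠ 2 → (ℓ : ℤ) ∣ W.minimalDiscriminantInt → ℓ ∈ P)
    (C e k : ℕ → ℕ) (he : ∀ ℓ ∈ P, ¬ 2 ^ (e ℓ + 4) ∣ ℓ ^ 2 - 1)
    (hC : ∀ (ℓ : ℕ) [Fact ℓ.Prime], ℓ ∈ P →
      4 ≤ C ℓ ∨ (W.HasMultiplicativeReductionAtPrime ℓ ∧ 2 ≤ C ℓ) ∨
        (W.HasMultiplicativeReductionAtPrime ℓ ∧ (ℓ : ℤ) ^ k ℓ ∣ W.minimalDiscriminantInt ∧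
          ¬ (ℓ : ℤ) ^ (k ℓ + 1) ∣ W.minimalDiscriminantInt ∧ ¬ 2 ∣ k ℓ ∧ 1 ≤ C ℓ) ∨
        (¬ (ℓ : ℤ) ∣ W.minimalDiscriminantInt ∧ 1 ≤ C ℓ))
    (hlow : ∀ κ : ZpExtension ℚ 2, κ.IsCyclotomic →
      2 ^ a ≤ Nat.card {z : W.selmerLayer κ j // 2 • z = 0})
    (hup : ∀ κ : ZpExtension ℚ 2, κ.IsCyclotomic →
      Nat.card {z : W.selmerLayer κ j' // 2 • z = 0} ≤ 2 ^ d)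
    (harith : 2 ^ d * 4 * ∏ ℓ ∈ P, C ℓ ^ 2 ^ min j' (e ℓ) < 2 ^ (2 ^ j' - 2 ^ j + a))
    (hsha : MissingLowerBoundAt W 2) : BSDp W 2 :=
  bsdp_two_of_layerSelmer_cert_of_missingLowerBoundAt W hmod hGZK h17 hEC
    lemma33_localTowerKerPrimary_eq_bot_of_good_holds hM hA hS34 hper₀ hgo hr htors hjj' P hP hΔ C e k he
    hC hlow hup harith hsha

/-- **Door (`Ш`-currency, decidable certificates): `MazurMainConjecture W 2` at analytic rank `0`,
`h33g` discharged** (as `mazurMainConjecture_two_of_layerSelmer_cert_of_missingLowerBoundAt`).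
[cite: Kato2004Asterisque, Thm. 17.4 (1)(2) (p. 273)] [cite: GreenbergLNM1716, Thm. 4.1 (p. 102), §3 Lemmas 3.3–3.5, Prop. 2.5] -/
theorem mazurMainConjecture_two_of_layerSelmer_cert_of_missingLowerBoundAt'
    (hmod : nonempty_modularParametrizationData) (hGZK : rank_eq_analyticRank_of_analyticRank_le_one)
    (h17 : ∀ [NeZero (W.conductorNorm ℤ)] (f : CuspForm (Gamma0 (W.conductorNorm ℤ)) 2),
      kato_divisibility_allPrimes W 2 (f := f))
    (hEC : TwoAdicEulerCharRankZero W 0)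
    (hM : lemma33_localTowerKerPrimary_cyclic_of_multiplicative.{0})
    (hA : lemma33_natCard_localTowerKerPrimary_le_four_of_additive.{0})
    (hS34 : lemma34_localTowerKerPrimary_cyclicExtension_rat)
    (hper₀ : ∀ [NeZero (W.conductorNorm ℤ)] (f : CuspForm (Gamma0 (W.conductorNorm ℤ)) 2),
      IsNewformOf W f → ∀ ϖ : ℚ, (ϖ : ℝ) * W.realPeriodRat = plusPeriod f → 0 ≤ padicValRat 2 ϖ)
    (hgo : GoodOrd W 2) (hr : W.analyticRank = 0) (htors : ¬ 2 ∣ W.torsionOrder) {j j' a d : ℕ}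
    (hjj' : j ≤ j') (P : Finset ℕ) (hP : ∀ ℓ ∈ P, ℓ.Prime ∧ ℓ ≠ 2)
    (hΔ : ∀ ℓ : ℕ, ℓ.Prime → ℓ ≠ 2 → (ℓ : ℤ) ∣ W.minimalDiscriminantInt → ℓ ∈ P)
    (C e k : ℕ → ℕ) (he : ∀ ℓ ∈ P, ¬ 2 ^ (e ℓ + 4) ∣ ℓ ^ 2 - 1)
    (hC : ∀ (ℓ : ℕ) [Fact ℓ.Prime], ℓ ∈ P →
      4 ≤ C ℓ ∨ (W.HasMultiplicativeReductionAtPrime ℓ ∧ 2 ≤ C ℓ) ∨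
        (W.HasMultiplicativeReductionAtPrime ℓ ∧ (ℓ : ℤ) ^ k ℓ ∣ W.minimalDiscriminantInt ∧
          ¬ (ℓ : ℤ) ^ (k ℓ + 1) ∣ W.minimalDiscriminantInt ∧ ¬ 2 ∣ k ℓ ∧ 1 ≤ C ℓ) ∨
        (¬ (ℓ : ℤ) ∣ W.minimalDiscriminantInt ∧ 1 ≤ C ℓ))
    (hlow : ∀ κ : ZpExtension ℚ 2, κ.IsCyclotomic →
      2 ^ a ≤ Nat.card {z : W.selmerLayer κ j // 2 • z = 0})
    (hup : ∀ κ : ZpExtension ℚ 2, κ.IsCyclotomic →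
      Nat.card {z : W.selmerLayer κ j' // 2 • z = 0} ≤ 2 ^ d)
    (harith : 2 ^ d * 4 * ∏ ℓ ∈ P, C ℓ ^ 2 ^ min j' (e ℓ) < 2 ^ (2 ^ j' - 2 ^ j + a))
    (hsha : MissingLowerBoundAt W 2) : MazurMainConjecture W 2 :=
  mazurMainConjecture_two_of_layerSelmer_cert_of_missingLowerBoundAt W hmod hGZK h17 hEC
    lemma33_localTowerKerPrimary_eq_bot_of_good_holds hM hA hS34 hper₀ hgo hr htors hjj' P hP hΔ C e k he
    hC hlow hup harith hsha

end Curve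

end Summit.BirchSwinnertonDyer.BirchSwinnertonDyer.Theorems.KatoHalfPinch

end
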